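import Summits.BirchSwinnertonDyer.BirchSwinnertonDyer.Theorems.CyclotomicUntwistNineIntegralCoordinates
import Summits.BirchSwinnertonDyer.BirchSwinnertonDyer.Theorems.CyclotomicUntwistKatzFrobeniusRelation
import Summits.BirchSwinnertonDyer.BirchSwinnertonDyer.Theorems.CyclotomicUntwistDescendedFrobeniusTransferGoodModel
import Literature.NumberTheory.EllipticCurves.KatzDieudonneModuleRank
import Literature.NumberTheory.EllipticCurves.FormalLogExpBaseChangeProofs
import HarnessLib

/-!
# Katz's rank statement over `𝓞 = 𝓞_{ℚ₃(ζ₉)}` FROM the rank statement over `ℤ₃` (base change + congruence of group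
# laws modulo `ϖ`): `katz_dieudonne_rank_le_two ⟸ «every second-kind ℚ₃-series of a ℤ₃-curve with elliptic fibres is
# ≡ a·log + b·log(z³) modulo bounded denominators»` — work package W4 of the elementary route

Cell `pub/bsd-wall` (D-0145 line `route-BirchSwinnertonDyer-CyclotomicUntwist`), width seat `bsd-line-cycu-p4` (gen 8); work
package W4 (assembly) of cycu-p3 g8's memo `Cruxes/PSRankOneLowerHalfAtThree/KATZ-FROBENIUS-MOD-VARPI-v2.md`. THEOREMS ONLY
(no definition, no named fact, no `sorry`); helper `--supports` K1 = stmt-BirchSwinnertonDyer-21580. BSD is not proved by this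
file and no crux / stub is; the Literature fact `katz_dieudonne_rank_le_two` (p636408) is NOT proved here — it is REDUCED to
its unramified `ℤ₃`-form (binder `H3`, the target of W1+W3).

For `E/𝓞` with elliptic special fibre along `ρ : 𝓞 → 𝔽₃`, a coefficientwise `ℤ₃`-lift `V₀` of `E ⊗_ρ 𝔽₃`
(`KatzFrobenius.exists_padicInt_lift`) has elliptic fibres and `F_E ≡ F_{V₀} (mod ϖ)` coefficientwise (`ker ρ ⊆ (ϖ)`):

* §1 `hbd_map_of_isPadicInt`, `hbd_sum` — bookkeeping; `C_dvd_formalGroupLaw_sub_of_lift` (`F_E ≡ F_{V₀} mod ϖ`);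
* §2 **`cob_lift_bound`** — a second-kind series for `F_E` (log-type + bounded `F_E`-coboundary) has bounded
  `F_{V₀}`-coboundary (Katz's Key Lemma modulo `ϖ`, cycu-p3 `isIntegral_three_pow_mul_mvCoeff_subst_sub_subst`);
* §3 **`katz_dieudonne_rank_le_two_of_padicRankTwo`** — `H3 → katz_dieudonne_rank_le_two`, where
  `H3 := ∀ V₀/ℤ₃ (elliptic fibres) g ∈ ℚ₃⟦X⟧ second kind, ∃ a b d″, 3^{d″}(g − a·log_{V₀} − b·log_{V₀}(z³)) ∈ ℤ₃⟦X⟧`: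
  take `ℚ₃`-coordinates of the three `fᵢ` in the power basis of `ζ₉` (`NineCoordinates`: second-kind-ness passes to
  coordinates uniformly), apply `H3` to the `18` coordinate series, reassemble `fᵢ ≡ Aᵢ log + Bᵢ log(z³)` with
  `Aᵢ, Bᵢ ∈ L`, and take a non-trivial `L`-relation among three vectors of `L²`.

References: N. M. Katz, LNM 868 (1981) Thm 5.3.3 (rank `=` height, formation commutes with base change), Key Lemma 5.1.3
[Katz1981CrystallineDieudonne]; P. Berthelot, A. Ogus, Invent. Math. 72 (1983) (2.4) [BerthelotOgus1983].
-/

set_option autoImplicit false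
-- single-conjunct summit: `Summit.BirchSwinnertonDyer.BirchSwinnertonDyer.…` repeats the name by design
set_option linter.dupNamespace false

noncomputable section

open scoped Classical
open PowerSeries IsCyclotomicExtension Literature.NumberTheory.EllipticCurves
  Literature.NumberTheory.EllipticCurves.DescendedFrobenius
  Summit.BirchSwinnertonDyer.BirchSwinnertonDyer.Theorems.NineIntegers
  Summit.BirchSwinnertonDyer.BirchSwinnertonDyer.Theorems.DescendedFrobeniusTransfer
  Summit.BirchSwinnertonDyer.BirchSwinnertonDyer.Theorems.NineCoordinates

namespace Summit.BirchSwinnertonDyer.BirchSwinnertonDyer.Theorems.KatzRankBaseChange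

/-! ### §1 Bookkeeping -/

/-- A `ℚ₃`-series with `3ᵈ·g ∈ ℤ₃⟦X⟧` has bounded denominators over `L`. [folklore] -/
theorem hbd_map_of_isPadicInt {g : ℚ_[3]⟦X⟧} {d : ℕ} (h : IsPadicInt (PowerSeries.C ((3 : ℚ_[3]) ^ d) * g)) :
    HasBoundedDenominators (g.map (algebraMap ℚ_[3] KNine)) := by
  refine ⟨d, fun n ↦ ?_⟩
  have h3 : ‖(3 : ℚ_[3]) ^ d * coeff n g‖ ≤ 1 := by
    have := isPadicInt_iff_coeff.mp h n
    rwa [PowerSeries.coeff_C_mul] at this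
  set x : ℤ_[3] := ⟨(3 : ℚ_[3]) ^ d * coeff n g, h3⟩ with hx
  have e : (3 : KNine) ^ d * coeff n (g.map (algebraMap ℚ_[3] KNine)) = algebraMap ℤ_[3] KNine x := by
    rw [PowerSeries.coeff_map, IsScalarTower.algebraMap_apply ℤ_[3] ℚ_[3] KNine, hx]
    change (3 : KNine) ^ d * algebraMap ℚ_[3] KNine (coeff n g) = algebraMap ℚ_[3] KNine ((3 : ℚ_[3]) ^ d * coeff n g)
    rw [map_mul, map_pow, map_ofNat]
  rw [e]; exact isIntegral_algebraMap

/-- Finite sums of series with bounded denominators have bounded denominators. [folklore] -/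
theorem hbd_sum {ι : Type*} (s : Finset ι) (F : ι → KNine⟦X⟧) (h : ∀ i ∈ s, HasBoundedDenominators (F i)) :
    HasBoundedDenominators (∑ i ∈ s, F i) :=
  Finset.sum_induction F HasBoundedDenominators (fun _ _ ha hb => ha.add hb) HasBoundedDenominators.zero h

/-- **`F_E ≡ F_{V₀} (mod ϖ)`**: the group law of `E/𝓞` and of a `ℤ₃`-lift `V₀` of its special fibre agree coefficientwise
modulo any `ϖ` with `ker ρ ⊆ (ϖ)` (the group law commutes with base change). [cite: SilvermanAEC2009, IV.2] -/
theorem C_dvd_formalGroupLaw_sub_of_lift (E : WeierstrassCurve ONine) (ρ : ONine →+* ZMod 3) {ϖ : ONine}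
    (hker : ∀ x : ONine, ρ x = 0 → ϖ ∣ x) {V₀ : WeierstrassCurve ℤ_[3]} (hV : V₀.map PadicInt.toZMod = E.map ρ) :
    MvPowerSeries.C ϖ ∣ E.formalGroupLaw - (V₀.map (algebraMap ℤ_[3] ONine)).formalGroupLaw := by
  have hρ : ρ.comp (algebraMap ℤ_[3] ONine) = PadicInt.toZMod := ringHom_padicInt_eq_toZMod _
  have hmap : E.formalGroupLaw.map ρ = (V₀.map (algebraMap ℤ_[3] ONine)).formalGroupLaw.map ρ := by
    rw [WeierstrassCurve.map_formalGroupLaw, WeierstrassCurve.map_formalGroupLaw, WeierstrassCurve.map_map, hρ, hV]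
  have hc : ∀ e, ϖ ∣ MvPowerSeries.coeff e (E.formalGroupLaw - (V₀.map (algebraMap ℤ_[3] ONine)).formalGroupLaw) := by
    intro e
    apply hker
    have := congrArg (MvPowerSeries.coeff e) hmap
    rw [MvPowerSeries.coeff_map, MvPowerSeries.coeff_map] at this
    rw [map_sub, map_sub, this, sub_self]
  choose c hc' using hc
  refine ⟨fun e => c e, MvPowerSeries.ext fun e => ?_⟩
  rw [MvPowerSeries.coeff_C_mul]
  exact hc' e

/-! ### §2 Second kind for `F_E` ⟹ second kind for `F_{V₀}` -/

/-- **The `F_{V₀}`-coboundary of an `F_E`-second-kind series is bounded.** If `3ᵈ·n·[zⁿ]f ∈ 𝓞` and the `F_E`-coboundary of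
`f` is `3^{d′}`-bounded, then for any `ℤ₃`-lift `V₀` of the special fibre the `F_{V₀}`-coboundary of `f` is
`3^{d+1+d′}`-bounded: `f(F_E) − f(F_{V₀})` is `3^{d+1}`-bounded by Katz's Key Lemma modulo `ϖ`.
[cite: Katz1981CrystallineDieudonne, §5 Key Lemma 5.1.3] -/
theorem cob_lift_bound (E : WeierstrassCurve ONine) (ρ : ONine →+* ZMod 3) {V₀ : WeierstrassCurve ℤ_[3]}
    (hV : V₀.map PadicInt.toZMod = E.map ρ) {f : KNine⟦X⟧} {d : ℕ}
    (hf : ∀ n : ℕ, IsIntegral ℤ_[3] ((3 : KNine) ^ d * ((n : KNine) * coeff n f))) {d' : ℕ}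
    (hcob : ∀ e : Fin 2 →₀ ℕ, IsIntegral ℤ_[3] ((3 : KNine) ^ d' * MvPowerSeries.coeff e
      (f.subst (E.map (algebraMap ONine KNine)).formalGroupLaw - f.subst (MvPowerSeries.X 0) -
        f.subst (MvPowerSeries.X 1)))) (e : Fin 2 →₀ ℕ) :
    IsIntegral ℤ_[3] ((3 : KNine) ^ (d + 1 + d') * MvPowerSeries.coeff e
      (f.subst ((V₀.map (algebraMap ℤ_[3] KNine)).formalGroupLaw) - f.subst (MvPowerSeries.X 0) -
        f.subst (MvPowerSeries.X 1))) := by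
  set ι := algebraMap ONine KNine with hι
  obtain ⟨ϖ, θ, θ', h3, hθ, hker, -⟩ := KatzFrobenius.exists_uniformizer
  have hUV := C_dvd_formalGroupLaw_sub_of_lift E ρ (hker ρ) hV
  have hU0 : MvPowerSeries.constantCoeff E.formalGroupLaw = 0 := E.constantCoeff_formalGroupLaw
  have hV0 : MvPowerSeries.constantCoeff (V₀.map (algebraMap ℤ_[3] ONine)).formalGroupLaw = 0 :=
    (V₀.map (algebraMap ℤ_[3] ONine)).constantCoeff_formalGroupLaw
  have hkey := KatzFrobenius.isIntegral_three_pow_mul_mvCoeff_subst_sub_subst h3 hθ hf hU0 hV0 hUV e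
  have hE : (E.map ι).formalGroupLaw = E.formalGroupLaw.map ι := (WeierstrassCurve.map_formalGroupLaw E ι).symm
  have hV' : (V₀.map (algebraMap ℤ_[3] KNine)).formalGroupLaw = (V₀.map (algebraMap ℤ_[3] ONine)).formalGroupLaw.map ι := by
    rw [WeierstrassCurve.map_formalGroupLaw, WeierstrassCurve.map_map, hι, ← IsScalarTower.algebraMap_eq ℤ_[3] ONine KNine]
  have edec : f.subst ((V₀.map (algebraMap ℤ_[3] KNine)).formalGroupLaw) - f.subst (MvPowerSeries.X 0) -
        f.subst (MvPowerSeries.X 1) =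
      (f.subst (E.map ι).formalGroupLaw - f.subst (MvPowerSeries.X 0) - f.subst (MvPowerSeries.X 1)) -
        (f.subst (E.formalGroupLaw.map ι) - f.subst ((V₀.map (algebraMap ℤ_[3] ONine)).formalGroupLaw.map ι)) := by
    rw [hE, hV']; ring
  rw [edec, map_sub, mul_sub]
  refine IsIntegral.sub ?_ ?_
  · rw [pow_add, mul_assoc]
    exact (KatzFrobenius.isIntegral_three_pow (d + 1)).mul (hcob e)
  · rw [pow_add, mul_comm ((3 : KNine) ^ (d + 1)), mul_assoc]
    exact (KatzFrobenius.isIntegral_three_pow d').mul hkey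

/-! ### §3 The rank statement over `𝓞` from the rank statement over `ℤ₃` -/

/-- **KATZ'S RANK `≤ 2` OVER `𝓞_{ℚ₃(ζ₉)}` FROM THE `ℤ₃`-STATEMENT.** If for every Weierstrass equation `V₀/ℤ₃` with elliptic
generic and special fibres every second-kind series `g ∈ ℚ₃⟦X⟧` (no constant term, `3ᵈ·n·gₙ ∈ ℤ₃`, `F_{V₀}`-coboundary
`3^{d′}`-bounded) satisfies `3^{d″}·(g − a·log_{V₀} − b·log_{V₀}(z³)) ∈ ℤ₃⟦X⟧` for some `a, b ∈ ℚ₃` (rank `≤ 2` of Katz's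
module over the UNRAMIFIED base, spanned by `[ω]` and `φ[ω]`), then `katz_dieudonne_rank_le_two` holds over `𝓞`: any three
second-kind `L`-series of an `𝓞`-model with elliptic special fibre are `L`-dependent modulo bounded denominators.
[cite: Katz1981CrystallineDieudonne, Thm. 5.3.3] -/
theorem katz_dieudonne_rank_le_two_of_padicRankTwo
    (H3 : ∀ (V₀ : WeierstrassCurve ℤ_[3]) [(V₀.map PadicInt.Coe.ringHom).IsElliptic]
      [(V₀.map PadicInt.toZMod).IsElliptic] (g : ℚ_[3]⟦X⟧), constantCoeff g = 0 →
      (∃ d : ℕ, ∀ n : ℕ, ‖(3 : ℚ_[3]) ^ d * ((n : ℚ_[3]) * coeff n g)‖ ≤ 1) →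
      (∃ d' : ℕ, ∀ e : Fin 2 →₀ ℕ, ‖(3 : ℚ_[3]) ^ d' * MvPowerSeries.coeff e
        (g.subst (V₀.map PadicInt.Coe.ringHom).formalGroupLaw - g.subst (MvPowerSeries.X 0) -
          g.subst (MvPowerSeries.X 1))‖ ≤ 1) →
      ∃ (a b : ℚ_[3]) (d'' : ℕ), ∀ n : ℕ, ‖(3 : ℚ_[3]) ^ d'' * coeff n
        (g - PowerSeries.C a * (V₀.map PadicInt.Coe.ringHom).formalLog -
          PowerSeries.C b * expand 3 (by norm_num) (V₀.map PadicInt.Coe.ringHom).formalLog)‖ ≤ 1) :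
    katz_dieudonne_rank_le_two := by
  intro E ρ hΔ f hf
  set ι := algebraMap ONine KNine with hι
  set ι₃ := algebraMap ℚ_[3] KNine with hι₃
  set pb := zeta_spec.powerBasis ℚ_[3] with hpb
  -- the lift and its fibres
  obtain ⟨V₀, hV⟩ := KatzFrobenius.exists_padicInt_lift (E.map ρ)
  haveI hEt : (V₀.map PadicInt.toZMod).IsElliptic := ⟨by rw [hV]; exact hΔ⟩
  haveI hE0 : (V₀.map PadicInt.Coe.ringHom).IsElliptic := KatzFrobenius.isElliptic_map_coe_of_isElliptic_map_toZMod V₀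
  set W₀ := V₀.map (PadicInt.Coe.ringHom (p := 3)) with hW₀
  set F₀ := W₀.formalGroupLaw with hF₀
  set ℓ₀ := W₀.formalLog with hℓ₀
  have hcoe : (PadicInt.Coe.ringHom (p := 3)) = algebraMap ℤ_[3] ℚ_[3] := rfl
  have hF₀K : (V₀.map (algebraMap ℤ_[3] KNine)).formalGroupLaw = F₀.map ι₃ := by
    rw [hF₀, hW₀, WeierstrassCurve.map_formalGroupLaw, WeierstrassCurve.map_map, hcoe, hι₃,
      ← IsScalarTower.algebraMap_eq ℤ_[3] ℚ_[3] KNine]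
  have hF₀0 : MvPowerSeries.constantCoeff F₀ = 0 := W₀.constantCoeff_formalGroupLaw
  have hX0 : ∀ k : Fin 2, (MvPowerSeries.X k : MvPowerSeries (Fin 2) KNine) =
      (MvPowerSeries.X k : MvPowerSeries (Fin 2) ℚ_[3]).map ι₃ := fun k => (MvPowerSeries.map_X ι₃ k).symm
  have hX00 : ∀ k : Fin 2, MvPowerSeries.constantCoeff (MvPowerSeries.X k : MvPowerSeries (Fin 2) ℚ_[3]) = 0 :=
    fun k => MvPowerSeries.constantCoeff_X k
  -- coordinates of the three series
  have hcoords : ∀ i : Fin 3, ∃ G : Fin pb.dim → ℚ_[3]⟦X⟧,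
      ∀ (e : Unit →₀ ℕ) (j : Fin pb.dim), pb.basis.repr (MvPowerSeries.coeff e (f i)) j = MvPowerSeries.coeff e (G j) :=
    fun i => exists_coords (σ := Unit) (f i)
  choose g hg using hcoords
  -- each coordinate series is of the second kind for `F₀`, and `H3` applies
  have hspan : ∀ i j, ∃ (a b : ℚ_[3]) (d'' : ℕ), ∀ n : ℕ, ‖(3 : ℚ_[3]) ^ d'' * coeff n
      (g i j - PowerSeries.C a * ℓ₀ - PowerSeries.C b * expand 3 (by norm_num) ℓ₀)‖ ≤ 1 := by
    intro i j
    obtain ⟨hf0, ⟨d, hd⟩, ⟨d', hd'⟩⟩ := hf i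
    refine H3 V₀ (g i j) ?_ ⟨d, fun n => coords_logType (hg i) hd n j⟩ ?_
    · exact coords_constantCoeff (hg i) hf0 j
    · -- coboundary for `F₀`: coordinates of the (bounded) `F_{V₀ ⊗ 𝓞}`-coboundary of `f i`
      have hcobL := cob_lift_bound E ρ hV hd hd'
      refine ⟨d + 1 + d', fun e => ?_⟩
      have hc : ∀ (e : Fin 2 →₀ ℕ) (j' : Fin pb.dim), pb.basis.repr (MvPowerSeries.coeff e
          ((f i).subst ((V₀.map (algebraMap ℤ_[3] KNine)).formalGroupLaw) - (f i).subst (MvPowerSeries.X 0) -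
            (f i).subst (MvPowerSeries.X 1))) j' =
          MvPowerSeries.coeff e ((g i j').subst F₀ - (g i j').subst (MvPowerSeries.X 0 : MvPowerSeries (Fin 2) ℚ_[3]) -
            (g i j').subst (MvPowerSeries.X 1 : MvPowerSeries (Fin 2) ℚ_[3])) := by
        intro e j'
        rw [hF₀K, hX0 0, hX0 1]
        simp only [map_sub, Finsupp.sub_apply]
        rw [coords_subst (hg i) hF₀0, coords_subst (hg i) (hX00 0), coords_subst (hg i) (hX00 1)]
      have key := ((hbd_coords_iff hc (d + 1 + d')).mp hcobL) j e
      rwa [MvPowerSeries.coeff_C_mul] at key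
  choose a b d'' hspan' using hspan
  -- reassemble over `L`
  set A : Fin 3 → KNine := fun i => ∑ j, ι₃ (a i j) * pb.basis j with hA
  set B : Fin 3 → KNine := fun i => ∑ j, ι₃ (b i j) * pb.basis j with hB
  have hrest : ∀ i, HasBoundedDenominators (f i - PowerSeries.C (A i) * ℓ₀.map ι₃ -
      PowerSeries.C (B i) * expand 3 (by norm_num) (ℓ₀.map ι₃)) := by
    intro i
    have hfi : f i = ∑ j, PowerSeries.C (pb.basis j) * (g i j).map ι₃ := eq_sum_of_coords (hg i)
    have hsummand : ∀ j, PowerSeries.C (pb.basis j) * (g i j - PowerSeries.C (a i j) * ℓ₀ -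
        PowerSeries.C (b i j) * expand 3 (by norm_num) ℓ₀).map ι₃ =
        PowerSeries.C (pb.basis j) * (g i j).map ι₃ - PowerSeries.C (ι₃ (a i j) * pb.basis j) * ℓ₀.map ι₃ -
          PowerSeries.C (ι₃ (b i j) * pb.basis j) * expand 3 (by norm_num) (ℓ₀.map ι₃) := by
      intro j
      rw [map_sub, map_sub, map_mul, map_mul, PowerSeries.map_C, PowerSeries.map_C, PowerSeries.map_expand,
        map_mul PowerSeries.C, map_mul PowerSeries.C]
      ring
    have hAi : PowerSeries.C (A i) * ℓ₀.map ι₃ = ∑ j, PowerSeries.C (ι₃ (a i j) * pb.basis j) * ℓ₀.map ι₃ := by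
      rw [hA]; simp only [map_sum, Finset.sum_mul]
    have hBi : PowerSeries.C (B i) * expand 3 (by norm_num) (ℓ₀.map ι₃) =
        ∑ j, PowerSeries.C (ι₃ (b i j) * pb.basis j) * expand 3 (by norm_num) (ℓ₀.map ι₃) := by
      rw [hB]; simp only [map_sum, Finset.sum_mul]
    have e : f i - PowerSeries.C (A i) * ℓ₀.map ι₃ - PowerSeries.C (B i) * expand 3 (by norm_num) (ℓ₀.map ι₃) =
        ∑ j, PowerSeries.C (pb.basis j) * (g i j - PowerSeries.C (a i j) * ℓ₀ -
          PowerSeries.C (b i j) * expand 3 (by norm_num) ℓ₀).map ι₃ := by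
      rw [Finset.sum_congr rfl (fun j _ => hsummand j), Finset.sum_sub_distrib, Finset.sum_sub_distrib, ← hfi, ← hAi,
        ← hBi]
    rw [e]
    refine hbd_sum _ _ fun j _ => hbd_C_mul _ (hbd_map_of_isPadicInt (d := d'' i j) ?_)
    exact isPadicInt_iff_coeff.mpr fun n => by rw [PowerSeries.coeff_C_mul]; exact hspan' i j n
  -- three vectors in `L²` are dependent
  have hdep : ¬ LinearIndependent KNine (fun i : Fin 3 => (![A i, B i] : Fin 2 → KNine)) := by
    intro hli
    have := hli.fintype_card_le_finrank
    rw [Fintype.card_fin, Module.finrank_fin_fun] at this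
    omega
  obtain ⟨c, hc0, i₀, hi₀⟩ := Fintype.not_linearIndependent_iff.mp hdep
  have hcA : ∑ i, c i * A i = 0 := by
    have := congrFun hc0 0
    simpa [Finset.sum_apply, Pi.smul_apply, smul_eq_mul] using this
  have hcB : ∑ i, c i * B i = 0 := by
    have := congrFun hc0 1
    simpa [Finset.sum_apply, Pi.smul_apply, smul_eq_mul] using this
  refine ⟨c, fun h => hi₀ (by rw [h]; rfl), ?_⟩
  have e : ∑ i, PowerSeries.C (c i) * f i =
      ∑ i, PowerSeries.C (c i) * (f i - PowerSeries.C (A i) * ℓ₀.map ι₃ -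
        PowerSeries.C (B i) * expand 3 (by norm_num) (ℓ₀.map ι₃)) +
      PowerSeries.C (∑ i, c i * A i) * ℓ₀.map ι₃ + PowerSeries.C (∑ i, c i * B i) * expand 3 (by norm_num) (ℓ₀.map ι₃) := by
    simp only [map_sum, map_mul, Finset.sum_mul, ← Finset.sum_add_distrib]
    refine Finset.sum_congr rfl fun i _ => ?_
    ring
  rw [e, hcA, hcB, map_zero, zero_mul, zero_mul, add_zero, add_zero]
  exact hbd_sum _ _ fun i _ => hbd_C_mul _ (hrest i)

/-! ### §4 The same under a side condition on the special fibre (e.g. supersingularity) -/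

/-- **Rank `≤ 2` over `𝓞` from the `ℤ₃`-statement, under any condition `P` on the special fibre** (the `ℤ₃`-statement is
asked only for lifts whose reduction satisfies `P`; the conclusion is the rank statement for `𝓞`-models whose special fibre
satisfies `P`). With `P Ē := 3 ∣ tr(Ē)` this is the supersingular door of the K-SEP skeleton (stub `S2k`).
[cite: Katz1981CrystallineDieudonne, Thm. 5.3.3] -/
theorem rankLeTwo_of_padicRankTwo_of (P : WeierstrassCurve (ZMod 3) → Prop)
    (H3P : ∀ (V₀ : WeierstrassCurve ℤ_[3]) [(V₀.map PadicInt.Coe.ringHom).IsElliptic]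
      [(V₀.map PadicInt.toZMod).IsElliptic], P (V₀.map PadicInt.toZMod) → ∀ (g : ℚ_[3]⟦X⟧), constantCoeff g = 0 →
      (∃ d : ℕ, ∀ n : ℕ, ‖(3 : ℚ_[3]) ^ d * ((n : ℚ_[3]) * coeff n g)‖ ≤ 1) →
      (∃ d' : ℕ, ∀ e : Fin 2 →₀ ℕ, ‖(3 : ℚ_[3]) ^ d' * MvPowerSeries.coeff e
        (g.subst (V₀.map PadicInt.Coe.ringHom).formalGroupLaw - g.subst (MvPowerSeries.X 0) -
          g.subst (MvPowerSeries.X 1))‖ ≤ 1) →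
      ∃ (a b : ℚ_[3]) (d'' : ℕ), ∀ n : ℕ, ‖(3 : ℚ_[3]) ^ d'' * coeff n
        (g - PowerSeries.C a * (V₀.map PadicInt.Coe.ringHom).formalLog -
          PowerSeries.C b * expand 3 (by norm_num) (V₀.map PadicInt.Coe.ringHom).formalLog)‖ ≤ 1) :
    ∀ (E : WeierstrassCurve ONine) (ρ : ONine →+* ZMod 3), IsUnit (E.map ρ).Δ → P (E.map ρ) →
      ∀ f : Fin 3 → KNine⟦X⟧,
        (∀ i, constantCoeff (f i) = 0 ∧
          (∃ d : ℕ, ∀ n : ℕ, IsIntegral ℤ_[3] ((3 : KNine) ^ d * ((n : KNine) * coeff n (f i)))) ∧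
          (∃ d' : ℕ, ∀ e : Fin 2 →₀ ℕ, IsIntegral ℤ_[3] ((3 : KNine) ^ d' * MvPowerSeries.coeff e
            ((f i).subst (E.map (algebraMap ONine KNine)).formalGroupLaw - (f i).subst (MvPowerSeries.X 0) -
              (f i).subst (MvPowerSeries.X 1))))) →
        ∃ a : Fin 3 → KNine, a ≠ 0 ∧ HasBoundedDenominators (∑ i, PowerSeries.C (a i) * f i) := by
  intro E ρ hΔ hPE f hf
  set ι := algebraMap ONine KNine with hι
  set ι₃ := algebraMap ℚ_[3] KNine with hι₃
  set pb := zeta_spec.powerBasis ℚ_[3] with hpb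
  -- the lift and its fibres
  obtain ⟨V₀, hV⟩ := KatzFrobenius.exists_padicInt_lift (E.map ρ)
  haveI hEt : (V₀.map PadicInt.toZMod).IsElliptic := ⟨by rw [hV]; exact hΔ⟩
  haveI hE0 : (V₀.map PadicInt.Coe.ringHom).IsElliptic := KatzFrobenius.isElliptic_map_coe_of_isElliptic_map_toZMod V₀
  have hP : P (V₀.map PadicInt.toZMod) := by rw [hV]; exact hPE
  set W₀ := V₀.map (PadicInt.Coe.ringHom (p := 3)) with hW₀
  set F₀ := W₀.formalGroupLaw with hF₀
  set ℓ₀ := W₀.formalLog with hℓ₀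
  have hcoe : (PadicInt.Coe.ringHom (p := 3)) = algebraMap ℤ_[3] ℚ_[3] := rfl
  have hF₀K : (V₀.map (algebraMap ℤ_[3] KNine)).formalGroupLaw = F₀.map ι₃ := by
    rw [hF₀, hW₀, WeierstrassCurve.map_formalGroupLaw, WeierstrassCurve.map_map, hcoe, hι₃,
      ← IsScalarTower.algebraMap_eq ℤ_[3] ℚ_[3] KNine]
  have hF₀0 : MvPowerSeries.constantCoeff F₀ = 0 := W₀.constantCoeff_formalGroupLaw
  have hX0 : ∀ k : Fin 2, (MvPowerSeries.X k : MvPowerSeries (Fin 2) KNine) =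
      (MvPowerSeries.X k : MvPowerSeries (Fin 2) ℚ_[3]).map ι₃ := fun k => (MvPowerSeries.map_X ι₃ k).symm
  have hX00 : ∀ k : Fin 2, MvPowerSeries.constantCoeff (MvPowerSeries.X k : MvPowerSeries (Fin 2) ℚ_[3]) = 0 :=
    fun k => MvPowerSeries.constantCoeff_X k
  -- coordinates of the three series
  have hcoords : ∀ i : Fin 3, ∃ G : Fin pb.dim → ℚ_[3]⟦X⟧,
      ∀ (e : Unit →₀ ℕ) (j : Fin pb.dim), pb.basis.repr (MvPowerSeries.coeff e (f i)) j = MvPowerSeries.coeff e (G j) :=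
    fun i => exists_coords (σ := Unit) (f i)
  choose g hg using hcoords
  -- each coordinate series is of the second kind for `F₀`, and `H3` applies
  have hspan : ∀ i j, ∃ (a b : ℚ_[3]) (d'' : ℕ), ∀ n : ℕ, ‖(3 : ℚ_[3]) ^ d'' * coeff n
      (g i j - PowerSeries.C a * ℓ₀ - PowerSeries.C b * expand 3 (by norm_num) ℓ₀)‖ ≤ 1 := by
    intro i j
    obtain ⟨hf0, ⟨d, hd⟩, ⟨d', hd'⟩⟩ := hf i
    refine H3P V₀ hP (g i j) ?_ ⟨d, fun n => coords_logType (hg i) hd n j⟩ ?_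
    · exact coords_constantCoeff (hg i) hf0 j
    · -- coboundary for `F₀`: coordinates of the (bounded) `F_{V₀ ⊗ 𝓞}`-coboundary of `f i`
      have hcobL := cob_lift_bound E ρ hV hd hd'
      refine ⟨d + 1 + d', fun e => ?_⟩
      have hc : ∀ (e : Fin 2 →₀ ℕ) (j' : Fin pb.dim), pb.basis.repr (MvPowerSeries.coeff e
          ((f i).subst ((V₀.map (algebraMap ℤ_[3] KNine)).formalGroupLaw) - (f i).subst (MvPowerSeries.X 0) -
            (f i).subst (MvPowerSeries.X 1))) j' =
          MvPowerSeries.coeff e ((g i j').subst F₀ - (g i j').subst (MvPowerSeries.X 0 : MvPowerSeries (Fin 2) ℚ_[3]) -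
            (g i j').subst (MvPowerSeries.X 1 : MvPowerSeries (Fin 2) ℚ_[3])) := by
        intro e j'
        rw [hF₀K, hX0 0, hX0 1]
        simp only [map_sub, Finsupp.sub_apply]
        rw [coords_subst (hg i) hF₀0, coords_subst (hg i) (hX00 0), coords_subst (hg i) (hX00 1)]
      have key := ((hbd_coords_iff hc (d + 1 + d')).mp hcobL) j e
      rwa [MvPowerSeries.coeff_C_mul] at key
  choose a b d'' hspan' using hspan
  -- reassemble over `L`
  set A : Fin 3 → KNine := fun i => ∑ j, ι₃ (a i j) * pb.basis j with hA
  set B : Fin 3 → KNine := fun i => ∑ j, ι₃ (b i j) * pb.basis j with hB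
  have hrest : ∀ i, HasBoundedDenominators (f i - PowerSeries.C (A i) * ℓ₀.map ι₃ -
      PowerSeries.C (B i) * expand 3 (by norm_num) (ℓ₀.map ι₃)) := by
    intro i
    have hfi : f i = ∑ j, PowerSeries.C (pb.basis j) * (g i j).map ι₃ := eq_sum_of_coords (hg i)
    have hsummand : ∀ j, PowerSeries.C (pb.basis j) * (g i j - PowerSeries.C (a i j) * ℓ₀ -
        PowerSeries.C (b i j) * expand 3 (by norm_num) ℓ₀).map ι₃ =
        PowerSeries.C (pb.basis j) * (g i j).map ι₃ - PowerSeries.C (ι₃ (a i j) * pb.basis j) * ℓ₀.map ι₃ -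
          PowerSeries.C (ι₃ (b i j) * pb.basis j) * expand 3 (by norm_num) (ℓ₀.map ι₃) := by
      intro j
      rw [map_sub, map_sub, map_mul, map_mul, PowerSeries.map_C, PowerSeries.map_C, PowerSeries.map_expand,
        map_mul PowerSeries.C, map_mul PowerSeries.C]
      ring
    have hAi : PowerSeries.C (A i) * ℓ₀.map ι₃ = ∑ j, PowerSeries.C (ι₃ (a i j) * pb.basis j) * ℓ₀.map ι₃ := by
      rw [hA]; simp only [map_sum, Finset.sum_mul]
    have hBi : PowerSeries.C (B i) * expand 3 (by norm_num) (ℓ₀.map ι₃) =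
        ∑ j, PowerSeries.C (ι₃ (b i j) * pb.basis j) * expand 3 (by norm_num) (ℓ₀.map ι₃) := by
      rw [hB]; simp only [map_sum, Finset.sum_mul]
    have e : f i - PowerSeries.C (A i) * ℓ₀.map ι₃ - PowerSeries.C (B i) * expand 3 (by norm_num) (ℓ₀.map ι₃) =
        ∑ j, PowerSeries.C (pb.basis j) * (g i j - PowerSeries.C (a i j) * ℓ₀ -
          PowerSeries.C (b i j) * expand 3 (by norm_num) ℓ₀).map ι₃ := by
      rw [Finset.sum_congr rfl (fun j _ => hsummand j), Finset.sum_sub_distrib, Finset.sum_sub_distrib, ← hfi, ← hAi,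
        ← hBi]
    rw [e]
    refine hbd_sum _ _ fun j _ => hbd_C_mul _ (hbd_map_of_isPadicInt (d := d'' i j) ?_)
    exact isPadicInt_iff_coeff.mpr fun n => by rw [PowerSeries.coeff_C_mul]; exact hspan' i j n
  -- three vectors in `L²` are dependent
  have hdep : ¬ LinearIndependent KNine (fun i : Fin 3 => (![A i, B i] : Fin 2 → KNine)) := by
    intro hli
    have := hli.fintype_card_le_finrank
    rw [Fintype.card_fin, Module.finrank_fin_fun] at this
    omega
  obtain ⟨c, hc0, i₀, hi₀⟩ := Fintype.not_linearIndependent_iff.mp hdep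
  have hcA : ∑ i, c i * A i = 0 := by
    have := congrFun hc0 0
    simpa [Finset.sum_apply, Pi.smul_apply, smul_eq_mul] using this
  have hcB : ∑ i, c i * B i = 0 := by
    have := congrFun hc0 1
    simpa [Finset.sum_apply, Pi.smul_apply, smul_eq_mul] using this
  refine ⟨c, fun h => hi₀ (by rw [h]; rfl), ?_⟩
  have e : ∑ i, PowerSeries.C (c i) * f i =
      ∑ i, PowerSeries.C (c i) * (f i - PowerSeries.C (A i) * ℓ₀.map ι₃ -
        PowerSeries.C (B i) * expand 3 (by norm_num) (ℓ₀.map ι₃)) +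
      PowerSeries.C (∑ i, c i * A i) * ℓ₀.map ι₃ + PowerSeries.C (∑ i, c i * B i) * expand 3 (by norm_num) (ℓ₀.map ι₃) := by
    simp only [map_sum, map_mul, Finset.sum_mul, ← Finset.sum_add_distrib]
    refine Finset.sum_congr rfl fun i _ => ?_
    ring
  rw [e, hcA, hcB, map_zero, zero_mul, zero_mul, add_zero, add_zero]
  exact hbd_sum _ _ fun i _ => hbd_C_mul _ (hrest i)

/-- **Stub `S2k` of the K-SEP skeletons (`stub_KATZ_rankLeTwo_supersingular`, lead cycu-p1 g6, Lines/dfrob_wan v3 /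
dfrob_kato v3) FROM the supersingular `ℤ₃`-statement** — the target of cycu-p3's W1+W3 (Honda functional equation +
3-adic digit expansion in `End_{𝔽₃}(F̄) = ℤ₃[π]`, which uses `3 ∣ a`). [cite: Katz1981CrystallineDieudonne, Thm. 5.3.3] -/
theorem stub_KATZ_rankLeTwo_supersingular_of_padicRankTwo
    (H3ss : ∀ (V₀ : WeierstrassCurve ℤ_[3]) [(V₀.map PadicInt.Coe.ringHom).IsElliptic]
      [(V₀.map PadicInt.toZMod).IsElliptic], (3 : ℤ) ∣ HasseManin.tr (V₀.map PadicInt.toZMod) →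
      ∀ (g : ℚ_[3]⟦X⟧), constantCoeff g = 0 →
      (∃ d : ℕ, ∀ n : ℕ, ‖(3 : ℚ_[3]) ^ d * ((n : ℚ_[3]) * coeff n g)‖ ≤ 1) →
      (∃ d' : ℕ, ∀ e : Fin 2 →₀ ℕ, ‖(3 : ℚ_[3]) ^ d' * MvPowerSeries.coeff e
        (g.subst (V₀.map PadicInt.Coe.ringHom).formalGroupLaw - g.subst (MvPowerSeries.X 0) -
          g.subst (MvPowerSeries.X 1))‖ ≤ 1) →
      ∃ (a b : ℚ_[3]) (d'' : ℕ), ∀ n : ℕ, ‖(3 : ℚ_[3]) ^ d'' * coeff n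
        (g - PowerSeries.C a * (V₀.map PadicInt.Coe.ringHom).formalLog -
          PowerSeries.C b * expand 3 (by norm_num) (V₀.map PadicInt.Coe.ringHom).formalLog)‖ ≤ 1) :
    ∀ (E : WeierstrassCurve ONine) (ρ : ONine →+* ZMod 3), IsUnit (E.map ρ).Δ → (3 : ℤ) ∣ HasseManin.tr (E.map ρ) →
      ∀ f : Fin 3 → KNine⟦X⟧,
        (∀ i, constantCoeff (f i) = 0 ∧
          (∃ d : ℕ, ∀ n : ℕ, IsIntegral ℤ_[3] ((3 : KNine) ^ d * ((n : KNine) * coeff n (f i)))) ∧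
          (∃ d' : ℕ, ∀ e : Fin 2 →₀ ℕ, IsIntegral ℤ_[3] ((3 : KNine) ^ d' * MvPowerSeries.coeff e
            ((f i).subst (E.map (algebraMap ONine KNine)).formalGroupLaw - (f i).subst (MvPowerSeries.X 0) -
              (f i).subst (MvPowerSeries.X 1))))) →
        ∃ a : Fin 3 → KNine, a ≠ 0 ∧ HasBoundedDenominators (∑ i, PowerSeries.C (a i) * f i) :=
  rankLeTwo_of_padicRankTwo_of (fun Ē => (3 : ℤ) ∣ HasseManin.tr Ē) (fun V₀ _ _ hV₀ => H3ss V₀ hV₀)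


end Summit.BirchSwinnertonDyer.BirchSwinnertonDyer.Theorems.KatzRankBaseChange

end
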